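import Literature.AlgebraicGeometry.Resolution.CharPolyhedronVertexDissolution
import HarnessLib

/-!
# Solvable vertices and minimal characteristic polyhedra (Cossart–Piltant 2019, Def. 2.2–2.4)

Topic: `Literature/AlgebraicGeometry/Resolution`. DEFINITIONS (with API) continuing
`ArithmeticalThreefoldsLocalPolyhedron.lean` (`Δ_S(h; u; X)`, `δ_α`, `I_α(a)`),
`MonomialIdealsRegularParameters.lean` (Prop. 2.1: the expansion sets `𝐒(f)`) and
`CharPolyhedronVertexDissolution.lean` (the dissolution computation), in support of the named fact
`CossartPiltant2019Local` (`ArithmeticalThreefoldsLocal.lean`). Source: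

* V. Cossart, O. Piltant, *Resolution of singularities of arithmetical threefolds*, J. Algebra
  529 (2019) 268–535 = arXiv:1412.0868 (v1), Ch. 2, pp. 9–11: Prop. 2.1 (`𝐒(f)`, the classes
  `γ̄(f, a) = γ(f, a) + I_J`), Def. 2.2 (`σ_α`, `in_α h`, `F_{i,X,α}`), Def. 2.3 (solvable
  vertices), Prop. 2.2 (Hironaka), Def. 2.4 (minimal polyhedra).

## The notions (namespace `Literature.AlgebraicGeometry.Resolution.CossartPiltant`)

For `u : Fin N → S` (in the application: part `(u_j)_{j ∈ J}` of a regular system of parameters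
of a regular local ring `S`, `I_J = (u)`), `f ∈ S`, `h = X^m + f_{1,X} X^{m-1} + ⋯ + f_{m,X} ∈ S[X]`
(`f_{i,X} = coeff_{m-i} h`, `m = natDegree h`):

* `minExponents u f` — **`𝐒(f) ⊂ ℕ^N`** (Prop. 2.1): the finite antichain whose monomials
  minimally generate the smallest monomial ideal `I(f) ∋ f` (`∅` if no such antichain exists,
  which does not happen for a Noetherian local `S` and `u` satisfying (H) of
  `MonomialIdealsRegularParameters.lean`, `minExponents_spec`); unique (`minExponents_eq`).
* `coeffClass u f a` — **`γ̄(f, a) ∈ S/(u)`**: the class of the coefficient of `u^a` in an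
  expansion `f = Σ_{a ∈ 𝐒(f)} γ(f, a) u^a` (Prop. 2.1 (ii); independent of the expansion,
  `coeffClass_eq_mk`), and `0` if `a ∉ 𝐒(f)` (the paper's convention "`γ̄(f_{i,X}, ix) := 0`
  whenever `ix ∉ 𝐒(f_{i,X})`", v1 p. 10).
* `IsVertexFor u h α x` — **`σ_α(Δ_S(h; u; X)) = {x}`** (Def. 2.2): the compact face cut out by
  the weight vector `α` on the polyhedron of Def. 2.1,
  `Conv(⋃_i ⋃_{a ∈ 𝐒(f_{i,X})} (a/i + ℝ^N_{≥0}))`, is the single point `x`; i.e. `x` is a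
  generating point `a/i` and `|a'|_α / i' > |x|_α` for every other generating point.
* `IsSolvableVertex u h x` — **Def. 2.3**: `x ∈ ℕ^N` is a vertex (for some `α > 0`) and
  `in_x h = (X - λ̄ U^x)^m` for some `λ̄ ∈ S/(u)`, i.e.
  `γ̄(f_{i,X}, i x) = (-1)^i C(m, i) λ̄^i` for `1 ≤ i ≤ m`.
* `IsMinimal u h` — **Def. 2.4**: `Δ_S(h; u; X)` has no solvable vertex.

## API (PROVED)

* `minExponents_spec`, `minExponents_eq`, `mem_span_uPow_minExponents`,
  `minExponents_eq_empty_iff`; `coeffClass_eq_mk`, `coeffClass_eq_zero_of_not_mem`,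
  `coeffClass_ne_zero`;
* `IsVertexFor.mem_charPolyhedron` — a vertex lies in the (support-function rendering of the)
  polyhedron; `IsVertexFor.lt_of_ne` — the exposure inequality for integer vertices;
* `IsSolvableVertex.exists_dissolution_data` — a solvable vertex provides exactly the data of
  `taylor_coeff_mem_span_uPow_of_solvable`; hence
* `IsSolvableVertex.not_mem_charPolyhedron_taylor`, `IsSolvableVertex.charPolyhedron_taylor_ssubset`
  — **Prop. 2.2, "only if"**: dissolving a solvable vertex by `X' := X - λ u^x` yields a strictly
  smaller polyhedron; so
* `isMinimal_of_forall_subset` — a polyhedron which is smallest among all its translates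
  `Δ_S(h; u; X - θ)`, `θ ∈ S`, is minimal in the sense of Def. 2.4.

The converse (Prop. 2.2 "if", Hironaka's theorem [H3, (4.8)]: a polyhedron without solvable
vertices is the minimum over all translations, in `Ŝ`) and the algebraicity Prop. 2.4 ([CoP3])
are not treated here.
-/

noncomputable section

open Finset Polynomial IsLocalRing

namespace Literature.AlgebraicGeometry.Resolution.CossartPiltant

universe u

variable {S : Type u} [CommRing S] {N : ℕ}

/-! ## `𝐒(f)` (Prop. 2.1) -/

/-- **`𝐒(f)`** — the finite antichain of `ℕ^N` whose monomials `u^a` minimally generate the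
smallest monomial ideal containing `f` (Cossart–Piltant 2019, Prop. 2.1): characterized by
`f ∈ (u^a : a ∈ 𝐒(f))` and "`f ∈ (u^b : b ∈ B) ⇒` every `a ∈ 𝐒(f)` lies above some `b ∈ B`".
Set to `∅` when no such antichain exists (it exists for `S` Noetherian local and `u ⊆ m_S`
satisfying (H), `exists_minimal_span_uPow`). [cite: CossartPiltant2019, Prop. 2.1 (arXiv v1 p. 10)] -/
def minExponents (u : Fin N → S) (f : S) : Finset (Fin N → ℕ) := by
  classical
  exact if H : ∃ A : Finset (Fin N → ℕ), IsAntichain (· ≤ ·) (↑A : Set (Fin N → ℕ)) ∧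
      f ∈ Ideal.span (uPow u '' ↑A) ∧
      ∀ B : Set (Fin N → ℕ), f ∈ Ideal.span (uPow u '' B) → ∀ a ∈ A, ∃ b ∈ B, b ≤ a
    then H.choose else ∅

/-- The defining properties of `𝐒(f)`, whenever some antichain has them.
[cite: CossartPiltant2019, Prop. 2.1 (arXiv v1 p. 10)] -/
theorem minExponents_spec (u : Fin N → S) (f : S)
    (H : ∃ A : Finset (Fin N → ℕ), IsAntichain (· ≤ ·) (↑A : Set (Fin N → ℕ)) ∧
      f ∈ Ideal.span (uPow u '' ↑A) ∧
      ∀ B : Set (Fin N → ℕ), f ∈ Ideal.span (uPow u '' B) → ∀ a ∈ A, ∃ b ∈ B, b ≤ a) :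
    IsAntichain (· ≤ ·) (↑(minExponents u f) : Set (Fin N → ℕ)) ∧
      f ∈ Ideal.span (uPow u '' ↑(minExponents u f)) ∧
      ∀ B : Set (Fin N → ℕ), f ∈ Ideal.span (uPow u '' B) →
        ∀ a ∈ minExponents u f, ∃ b ∈ B, b ≤ a := by
  classical
  have : minExponents u f = H.choose := by
    unfold minExponents
    exact dif_pos H
  rw [this]
  exact H.choose_spec

/-- **Uniqueness (Prop. 2.1)**: any antichain with the defining properties is `𝐒(f)`.
[cite: CossartPiltant2019, Prop. 2.1 (arXiv v1 p. 10)] -/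
theorem minExponents_eq (u : Fin N → S) {f : S} {A : Finset (Fin N → ℕ)}
    (hA : IsAntichain (· ≤ ·) (↑A : Set (Fin N → ℕ))) (hfA : f ∈ Ideal.span (uPow u '' ↑A))
    (hmin : ∀ B : Set (Fin N → ℕ), f ∈ Ideal.span (uPow u '' B) → ∀ a ∈ A, ∃ b ∈ B, b ≤ a) :
    minExponents u f = A := by
  obtain ⟨h1, h2, h3⟩ := minExponents_spec u f ⟨A, hA, hfA, hmin⟩
  exact antichain_unique_of_forall_exists_le h1 hA (h3 _ hfA) (hmin _ h2)

/-- In the setting of Prop. 2.1 (`S` Noetherian local, `u ⊆ m_S` with (H)): `f ∈ (u^a : a ∈ 𝐒(f))`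
and `𝐒(f)` refines every monomial ideal containing `f`. [cite: CossartPiltant2019, Prop. 2.1 (arXiv v1 p. 10)] -/
theorem minExponents_spec' [IsNoetherianRing S] [IsLocalRing S] (u : Fin N → S)
    (H : ∀ (i : Fin N) (T : Finset (Fin N)), i ∉ T →
      ∀ y, u i * y ∈ Ideal.span (u '' ↑T) → y ∈ Ideal.span (u '' ↑T))
    (hu : ∀ i, u i ∈ maximalIdeal S) (f : S) :
    IsAntichain (· ≤ ·) (↑(minExponents u f) : Set (Fin N → ℕ)) ∧
      f ∈ Ideal.span (uPow u '' ↑(minExponents u f)) ∧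
      ∀ B : Set (Fin N → ℕ), f ∈ Ideal.span (uPow u '' B) →
        ∀ a ∈ minExponents u f, ∃ b ∈ B, b ≤ a :=
  minExponents_spec u f (exists_minimal_span_uPow u H hu f)

/-- `𝐒(f) = ∅ ⟺ f = 0` (in the setting of Prop. 2.1). [cite: CossartPiltant2019, Prop. 2.1 (arXiv v1 p. 10)] -/
theorem minExponents_eq_empty_iff [IsNoetherianRing S] [IsLocalRing S] (u : Fin N → S)
    (H : ∀ (i : Fin N) (T : Finset (Fin N)), i ∉ T →
      ∀ y, u i * y ∈ Ideal.span (u '' ↑T) → y ∈ Ideal.span (u '' ↑T))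
    (hu : ∀ i, u i ∈ maximalIdeal S) (f : S) :
    minExponents u f = ∅ ↔ f = 0 := by
  obtain ⟨-, h2, h3⟩ := minExponents_spec' u H hu f
  exact eq_empty_iff_eq_zero_of_minimal u h2 h3

/-! ## The coefficient classes `γ̄(f, a)` (Prop. 2.1 (ii), Def. 2.2) -/

/-- **`γ̄(f, a) ∈ S/(u)`** — the class of the coefficient `γ(f, a)` of `u^a` in an expansion
`f = Σ_{a ∈ 𝐒(f)} γ(f, a) u^a` (Prop. 2.1 (ii); any expansion gives the same class,
`coeffClass_eq_mk`), with the convention `γ̄(f, a) = 0` for `a ∉ 𝐒(f)` (v1 p. 10).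
[cite: CossartPiltant2019, Prop. 2.1 (ii) and Def. 2.2 (arXiv v1 p. 10)] -/
def coeffClass (u : Fin N → S) (f : S) (a : Fin N → ℕ) : S ⧸ Ideal.span (Set.range u) := by
  classical
  exact if H : a ∈ minExponents u f ∧
      ∃ γ : (Fin N → ℕ) → S, f = ∑ b ∈ minExponents u f, γ b * uPow u b
    then Ideal.Quotient.mk _ (H.2.choose a) else 0

/-- `γ̄(f, a) = 0` for `a ∉ 𝐒(f)`. [cite: CossartPiltant2019, Def. 2.2 (arXiv v1 p. 10)] -/
theorem coeffClass_eq_zero_of_not_mem (u : Fin N → S) {f : S} {a : Fin N → ℕ}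
    (ha : a ∉ minExponents u f) : coeffClass u f a = 0 := by
  classical
  unfold coeffClass
  rw [dif_neg]
  exact fun H => ha H.1

/-- An element of `(u^a : a ∈ 𝐒(f))` has an expansion over `𝐒(f)`. [folklore] -/
theorem exists_expansion_minExponents (u : Fin N → S) {f : S}
    (hf : f ∈ Ideal.span (uPow u '' ↑(minExponents u f))) :
    ∃ γ : (Fin N → ℕ) → S, f = ∑ b ∈ minExponents u f, γ b * uPow u b := by
  classical
  obtain ⟨c, hc⟩ := (Submodule.mem_span_image_finset_iff_exists_fun' (R := S)).mp hf
  simp only [smul_eq_mul] at hc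
  exact ⟨c, hc.symm⟩

/-- **`γ̄(f, a)` is the class of the coefficient in any expansion** over `𝐒(f)` (well-defined by
Prop. 2.1: two expansions have congruent coefficients modulo `(u)`; requires (H) and that `𝐒(f)`
has its defining properties). [cite: CossartPiltant2019, Prop. 2.1 (ii) (arXiv v1 p. 10)] -/
theorem coeffClass_eq_mk (u : Fin N → S)
    (H : ∀ (i : Fin N) (T : Finset (Fin N)), i ∉ T →
      ∀ y, u i * y ∈ Ideal.span (u '' ↑T) → y ∈ Ideal.span (u '' ↑T))
    {f : S} (hspec : IsAntichain (· ≤ ·) (↑(minExponents u f) : Set (Fin N → ℕ)))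
    {γ : (Fin N → ℕ) → S} (hγ : f = ∑ b ∈ minExponents u f, γ b * uPow u b)
    {a : Fin N → ℕ} (ha : a ∈ minExponents u f) :
    coeffClass u f a = Ideal.Quotient.mk _ (γ a) := by
  classical
  have Hex : a ∈ minExponents u f ∧
      ∃ γ : (Fin N → ℕ) → S, f = ∑ b ∈ minExponents u f, γ b * uPow u b := ⟨ha, γ, hγ⟩
  have : coeffClass u f a = Ideal.Quotient.mk _ (Hex.2.choose a) := by
    unfold coeffClass
    exact dif_pos Hex
  rw [this, Ideal.Quotient.eq]
  exact coeff_sub_coeff_mem_of_antichain u H hspec (Hex.2.choose_spec.symm.trans hγ) a ha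

/-- **Prop. 2.1 (ii)**: `γ̄(f, a) ≠ 0` for `a ∈ 𝐒(f)` (the coefficients `γ(f, a) ∉ I_J = (u)`), in
the setting of Prop. 2.1. [cite: CossartPiltant2019, Prop. 2.1 (ii) (arXiv v1 p. 10)] -/
theorem coeffClass_ne_zero [IsNoetherianRing S] [IsLocalRing S] (u : Fin N → S)
    (H : ∀ (i : Fin N) (T : Finset (Fin N)), i ∉ T →
      ∀ y, u i * y ∈ Ideal.span (u '' ↑T) → y ∈ Ideal.span (u '' ↑T))
    (hu : ∀ i, u i ∈ maximalIdeal S) {f : S} {a : Fin N → ℕ} (ha : a ∈ minExponents u f) :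
    coeffClass u f a ≠ 0 := by
  obtain ⟨h1, h2, h3⟩ := minExponents_spec' u H hu f
  obtain ⟨γ, hγ⟩ := exists_expansion_minExponents u h2
  rw [coeffClass_eq_mk u H h1 hγ ha, Ne, Ideal.Quotient.eq_zero_iff_mem]
  exact coeff_not_mem_of_minimal u h1 h3 hγ a ha

/-! ## Vertices `σ_α = {x}` (Def. 2.2), solvable vertices (Def. 2.3), minimality (Def. 2.4) -/

/-- **`σ_α(Δ_S(h; u; X)) = {x}`** — the weight vector `α` cuts out of the polyhedron of Def. 2.1,
`Conv(⋃_{i=1}^m ⋃_{a ∈ 𝐒(f_{i,X})} (a/i + ℝ^N_{≥0}))`, the single point `x` (Def. 2.2: "the weight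
vector defines a compact face `σ_α`"; a `0`-dimensional face `{x}` is a vertex, Def. 2.3): every
generating point `a/i` has `|a|_α / i ≥ |x|_α` with equality only for `a/i = x`, and `x` is a
generating point. [cite: CossartPiltant2019, Def. 2.2–2.3 (arXiv v1 pp. 10–11)] -/
def IsVertexFor (u : Fin N → S) (h : S[X]) (α : Fin N → ℝ) (x : Fin N → ℝ) : Prop :=
  (∀ i ∈ Finset.Icc 1 h.natDegree, ∀ a ∈ minExponents u (h.coeff (h.natDegree - i)),
      ∑ j, α j * x j ≤ weight α a / i ∧
      (weight α a / i = ∑ j, α j * x j → (fun j => (a j : ℝ) / i) = x)) ∧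
  ∃ i ∈ Finset.Icc 1 h.natDegree, ∃ a ∈ minExponents u (h.coeff (h.natDegree - i)),
      (fun j => (a j : ℝ) / i) = x

/-- **Solvable vertex** (Def. 2.3): `x ∈ ℕ^N` is a vertex of `Δ_S(h; u; X)` (for some weight
vector `α > 0`) and `in_x h = (X - λ̄ U^x)^m` for some `λ̄ ∈ S/(u)`, i.e.
`γ̄(f_{i,X}, i x) = (-1)^i C(m, i) λ̄^i = C(m, i) (-λ̄)^i` for `1 ≤ i ≤ m`.
[cite: CossartPiltant2019, Def. 2.3 (arXiv v1 p. 11)] -/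
def IsSolvableVertex (u : Fin N → S) (h : S[X]) (x : Fin N → ℕ) : Prop :=
  (∃ α : Fin N → ℝ, (∀ j, 0 < α j) ∧ IsVertexFor u h α (fun j => (x j : ℝ))) ∧
  ∃ lam : S, ∀ i ∈ Finset.Icc 1 h.natDegree,
    coeffClass u (h.coeff (h.natDegree - i)) (i • x) =
      Ideal.Quotient.mk _ ((h.natDegree.choose i : S) * (-lam) ^ i)

/-- **Minimal polyhedron** (Def. 2.4): `Δ_S(h; u; X)` is *minimal* if it has no solvable vertex.
(By Prop. 2.2 — Hironaka — this holds iff `Δ_Ŝ(h; u; X)` is the minimum over all translations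
`X' = X - φ`, `φ ∈ Ŝ`; here only the direction `isMinimal_of_forall_subset` is proved.)
[cite: CossartPiltant2019, Def. 2.4 (arXiv v1 p. 11)] -/
def IsMinimal (u : Fin N → S) (h : S[X]) : Prop :=
  ∀ x : Fin N → ℕ, ¬ IsSolvableVertex u h x

/-- Unfolding of `IsMinimal`. [cite: CossartPiltant2019, Def. 2.4 (arXiv v1 p. 11)] -/
theorem isMinimal_iff (u : Fin N → S) (h : S[X]) :
    IsMinimal u h ↔ ∀ x : Fin N → ℕ, ¬ IsSolvableVertex u h x :=
  Iff.rfl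

/-! ## API: vertices lie in the polyhedron; the exposure inequality -/

/-- **A vertex lies in `Δ_S(h; u; X)`** (rendering by support functions), in the setting of
Prop. 2.1. [cite: CossartPiltant2019, Def. 2.1–2.2 (arXiv v1 p. 10)] -/
theorem IsVertexFor.mem_charPolyhedron [IsNoetherianRing S] [IsLocalRing S] {u : Fin N → S}
    (H : ∀ (i : Fin N) (T : Finset (Fin N)), i ∉ T →
      ∀ y, u i * y ∈ Ideal.span (u '' ↑T) → y ∈ Ideal.span (u '' ↑T))
    (hu : ∀ i, u i ∈ maximalIdeal S) {h : S[X]} {α : Fin N → ℝ} {x : Fin N → ℝ}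
    (hx : IsVertexFor u h α x) : x ∈ charPolyhedron u h := by
  obtain ⟨-, i, hi, a, ha, rfl⟩ := hx
  exact smul_mem_charPolyhedron_of_minimal u hi (minExponents_spec' u H hu _).2.2 ha

/-- **The exposure inequality at an integer vertex**: for `a ∈ 𝐒(f_{k,X})` other than `k x`,
`|a|_α > k |x|_α`. [cite: CossartPiltant2019, Def. 2.2–2.3 (arXiv v1 pp. 10–11)] -/
theorem IsVertexFor.lt_of_ne {u : Fin N → S} {h : S[X]} {α : Fin N → ℝ} {x : Fin N → ℕ}
    (hx : IsVertexFor u h α (fun j => (x j : ℝ))) {k : ℕ} (hk : k ∈ Finset.Icc 1 h.natDegree)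
    {a : Fin N → ℕ} (ha : a ∈ minExponents u (h.coeff (h.natDegree - k))) (hne : a ≠ k • x) :
    (k : ℝ) * weight α x < weight α a := by
  have hkpos : (0 : ℝ) < k := by exact_mod_cast (Finset.mem_Icc.mp hk).1
  obtain ⟨hle, heq⟩ := hx.1 k hk a ha
  have hwx : ∑ j, α j * (x j : ℝ) = weight α x := rfl
  rw [hwx] at hle heq
  rcases hle.lt_or_eq with hlt | hEq
  · rw [lt_div_iff₀ hkpos, mul_comm] at hlt
    exact hlt
  · exfalso
    apply hne
    have hfun := heq hEq.symm
    funext j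
    have hj : (a j : ℝ) / k = (x j : ℝ) := congrFun hfun j
    rw [div_eq_iff hkpos.ne'] at hj
    have : (a j : ℝ) = ((k * x j : ℕ) : ℝ) := by
      rw [hj]
      push_cast
      ring
    exact_mod_cast (show (a j : ℝ) = ((k • x) j : ℕ) by simpa using this)

/-! ## Prop. 2.2, "only if": a solvable vertex can be dissolved -/

/-- **A solvable vertex provides the dissolution data** of
`taylor_coeff_mem_span_uPow_of_solvable`: expansions of the `f_{k,X}` over `𝐒(f_{k,X})`, the
exposing weight vector, and the solution `λ`. [cite: CossartPiltant2019, Def. 2.3 (arXiv v1 p. 11)] -/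
theorem IsSolvableVertex.exists_dissolution_data [IsNoetherianRing S] [IsLocalRing S]
    {u : Fin N → S}
    (H : ∀ (i : Fin N) (T : Finset (Fin N)), i ∉ T →
      ∀ y, u i * y ∈ Ideal.span (u '' ↑T) → y ∈ Ideal.span (u '' ↑T))
    (hu : ∀ i, u i ∈ maximalIdeal S) {h : S[X]} {x : Fin N → ℕ} (hx : IsSolvableVertex u h x) :
    ∃ (α : Fin N → ℝ) (lam : S) (γ : ℕ → (Fin N → ℕ) → S), (∀ j, 0 < α j) ∧
      IsVertexFor u h α (fun j => (x j : ℝ)) ∧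
      (∀ k ∈ Finset.Icc 1 h.natDegree, h.coeff (h.natDegree - k) =
        ∑ a ∈ minExponents u (h.coeff (h.natDegree - k)), γ k a * uPow u a) ∧
      (∀ k ∈ Finset.Icc 1 h.natDegree, ∀ a ∈ minExponents u (h.coeff (h.natDegree - k)),
        a ≠ k • x → (k : ℝ) * weight α x < weight α a) ∧
      (∀ k ∈ Finset.Icc 1 h.natDegree,
        (if k • x ∈ minExponents u (h.coeff (h.natDegree - k)) then γ k (k • x) else 0) -
          (h.natDegree.choose k : S) * (-lam) ^ k ∈ Ideal.span (Set.range u)) := by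
  classical
  obtain ⟨⟨α, hα, hvert⟩, lam, hsolv⟩ := hx
  -- expansions of each `f_{k,X}` over `𝐒(f_{k,X})`
  have hexp : ∀ k, ∃ γ : (Fin N → ℕ) → S, h.coeff (h.natDegree - k) =
      ∑ a ∈ minExponents u (h.coeff (h.natDegree - k)), γ a * uPow u a :=
    fun k => exists_expansion_minExponents u (minExponents_spec' u H hu _).2.1
  choose γ hγ using hexp
  refine ⟨α, lam, γ, hα, hvert, fun k _ => hγ k, fun k hk a ha hne => hvert.lt_of_ne hk ha hne,
    fun k hk => ?_⟩
  have hsk := hsolv k hk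
  by_cases hmem : k • x ∈ minExponents u (h.coeff (h.natDegree - k))
  · rw [if_pos hmem]
    rw [coeffClass_eq_mk u H (minExponents_spec' u H hu _).1 (hγ k) hmem, Ideal.Quotient.eq] at hsk
    exact hsk
  · rw [if_neg hmem, zero_sub]
    rw [coeffClass_eq_zero_of_not_mem u hmem, eq_comm, Ideal.Quotient.eq_zero_iff_mem] at hsk
    exact Submodule.neg_mem _ hsk

/-- **Prop. 2.2, "only if" (dissolution)**: if `x` is a solvable vertex with solution `λ̄`, then
for a suitable lift `λ ∈ S` the vertex `x` is no longer in `Δ_S(h; u; X')`, `X' := X - λ u^x`.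
[cite: CossartPiltant2019, Prop. 2.2 (arXiv v1 p. 11)] -/
theorem IsSolvableVertex.not_mem_charPolyhedron_taylor [IsNoetherianRing S] [IsLocalRing S]
    {u : Fin N → S}
    (H : ∀ (i : Fin N) (T : Finset (Fin N)), i ∉ T →
      ∀ y, u i * y ∈ Ideal.span (u '' ↑T) → y ∈ Ideal.span (u '' ↑T))
    (hu : ∀ i, u i ∈ maximalIdeal S) {h : S[X]} (hh : h.Monic) {x : Fin N → ℕ}
    (hx : IsSolvableVertex u h x) :
    ∃ lam : S, (fun j => (x j : ℝ)) ∉ charPolyhedron u (taylor (lam * uPow u x) h) := by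
  obtain ⟨α, lam, γ, hα, -, hexpand, hexpose, hsolv⟩ := hx.exists_dissolution_data H hu
  exact ⟨lam, not_mem_charPolyhedron_taylor_of_solvable u hα hh x lam _ γ hexpand hexpose hsolv⟩

/-- **Prop. 2.2, "only if"**: a solvable vertex yields a translate with strictly smaller
polyhedron, `Δ_S(h; u; X - λu^x) ⊊ Δ_S(h; u; X)`. [cite: CossartPiltant2019, Prop. 2.2 (arXiv v1 p. 11)] -/
theorem IsSolvableVertex.charPolyhedron_taylor_ssubset [IsNoetherianRing S] [IsLocalRing S]
    {u : Fin N → S}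
    (H : ∀ (i : Fin N) (T : Finset (Fin N)), i ∉ T →
      ∀ y, u i * y ∈ Ideal.span (u '' ↑T) → y ∈ Ideal.span (u '' ↑T))
    (hu : ∀ i, u i ∈ maximalIdeal S) {h : S[X]} (hh : h.Monic) {x : Fin N → ℕ}
    (hx : IsSolvableVertex u h x) :
    ∃ lam : S, charPolyhedron u (taylor (lam * uPow u x) h) ⊂ charPolyhedron u h := by
  obtain ⟨α, lam, γ, hα, hvert, hexpand, hexpose, hsolv⟩ := hx.exists_dissolution_data H hu
  have hxmem : (fun j => (x j : ℝ)) ∈ charPolyhedron u h := hvert.mem_charPolyhedron H hu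
  refine ⟨lam, (charPolyhedron_taylor_subset u hh hxmem lam).ssubset_of_ne fun heq => ?_⟩
  have hnot := not_mem_charPolyhedron_taylor_of_solvable u hα hh x lam _ γ hexpand hexpose hsolv
  rw [heq] at hnot
  exact hnot hxmem

/-- **A smallest translate is minimal** (Prop. 2.2, "only if", in the language of Def. 2.4): if
`Δ_S(h; u; X) ⊆ Δ_S(h; u; X - θ)` for every `θ ∈ S`, then `Δ_S(h; u; X)` has no solvable vertex.
[cite: CossartPiltant2019, Prop. 2.2 and Def. 2.4 (arXiv v1 p. 11)] -/
theorem isMinimal_of_forall_subset [IsNoetherianRing S] [IsLocalRing S] {u : Fin N → S}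
    (H : ∀ (i : Fin N) (T : Finset (Fin N)), i ∉ T →
      ∀ y, u i * y ∈ Ideal.span (u '' ↑T) → y ∈ Ideal.span (u '' ↑T))
    (hu : ∀ i, u i ∈ maximalIdeal S) {h : S[X]} (hh : h.Monic)
    (hmin : ∀ θ : S, charPolyhedron u h ⊆ charPolyhedron u (taylor θ h)) : IsMinimal u h := by
  intro x hx
  obtain ⟨lam, hss⟩ := hx.charPolyhedron_taylor_ssubset H hu hh
  exact hss.2 (hmin _)

/-! ## Prop. 2.3, proof: for a minimal polyhedron, `h̄ = (X - λ̄)^m` forces `λ̄ = 0` -/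

/-- An antichain containing `0` is `{0}`. [folklore] -/
theorem eq_singleton_zero_of_zero_mem {A : Finset (Fin N → ℕ)}
    (hA : IsAntichain (· ≤ ·) (↑A : Set (Fin N → ℕ))) (h0 : (0 : Fin N → ℕ) ∈ A) : A = {0} := by
  ext a
  simp only [Finset.mem_singleton]
  constructor
  · intro ha
    by_contra hne
    exact hA (Finset.mem_coe.mpr h0) (Finset.mem_coe.mpr ha) (Ne.symm hne) (fun j => Nat.zero_le _)
  · rintro rfl
    exact h0

/-- **`γ̄(f, 0) = f mod (u)`**: the constant coefficient class (`𝐒(f) = {0}` iff `f ∉ (u)`), in the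
setting of Prop. 2.1. [cite: CossartPiltant2019, Prop. 2.1 (ii) (arXiv v1 p. 10)] -/
theorem coeffClass_zero [IsNoetherianRing S] [IsLocalRing S] (u : Fin N → S)
    (H : ∀ (i : Fin N) (T : Finset (Fin N)), i ∉ T →
      ∀ y, u i * y ∈ Ideal.span (u '' ↑T) → y ∈ Ideal.span (u '' ↑T))
    (hu : ∀ i, u i ∈ maximalIdeal S) (f : S) :
    coeffClass u f 0 = Ideal.Quotient.mk _ f := by
  classical
  obtain ⟨h1, h2, h3⟩ := minExponents_spec' u H hu f
  obtain ⟨γ, hγ⟩ := exists_expansion_minExponents u h2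
  by_cases h0 : (0 : Fin N → ℕ) ∈ minExponents u f
  · have hA : minExponents u f = {0} := eq_singleton_zero_of_zero_mem h1 h0
    rw [coeffClass_eq_mk u H h1 hγ h0]
    congr 1
    have := hγ
    rw [hA, Finset.sum_singleton, uPow_zero, mul_one] at this
    exact this.symm
  · rw [coeffClass_eq_zero_of_not_mem u h0, eq_comm, Ideal.Quotient.eq_zero_iff_mem]
    -- `f ∈ (u^a : a ∈ 𝐒(f))` with all `a ≠ 0`
    refine (span_uPow_le_iff u).mpr (fun a ha => ?_) h2
    have hne : a ≠ 0 := fun hzero => h0 (hzero ▸ Finset.mem_coe.mp ha)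
    obtain ⟨l, hl⟩ : ∃ l, a l ≠ 0 := by
      by_contra hcon
      push Not at hcon
      exact hne (funext hcon)
    obtain ⟨c, hc⟩ := dvd_uPow_of_pos u (Nat.pos_of_ne_zero hl)
    rw [hc]
    exact Ideal.mul_mem_right _ _ (Ideal.subset_span (Set.mem_range_self l))

/-- `𝐒(f) = {0}` for `f ∉ (u)`. [cite: CossartPiltant2019, Prop. 2.1 (arXiv v1 p. 10)] -/
theorem minExponents_eq_singleton_zero (u : Fin N → S)
    (H : ∀ (i : Fin N) (T : Finset (Fin N)), i ∉ T →
      ∀ y, u i * y ∈ Ideal.span (u '' ↑T) → y ∈ Ideal.span (u '' ↑T))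
    {f : S} (hf : f ∉ Ideal.span (Set.range u)) : minExponents u f = {0} := by
  have hanti : IsAntichain (· ≤ ·) (↑({0} : Finset (Fin N → ℕ)) : Set (Fin N → ℕ)) := by
    rw [Finset.coe_singleton]
    exact IsAntichain.singleton
  have hexp : f = ∑ a ∈ ({0} : Finset (Fin N → ℕ)), (fun _ => f) a * uPow u a := by
    rw [Finset.sum_singleton, uPow_zero, mul_one]
  refine minExponents_eq u hanti ?_ (minimal_of_coeff_not_mem u H hanti (fun _ _ => hf) hexp)
  rw [Finset.coe_singleton, Set.image_singleton, uPow_zero, Ideal.span_singleton_one]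
  trivial

/-- **Prop. 2.3, proof** ("Since `Δ(h; u; Z)` is minimal, `0 ∈ ℝⁿ` is not a solvable vertex and
therefore we have `λ = 0`", v1 p. 12): if `Δ_S(h; u; X)` is minimal (Def. 2.4), `(u)` is prime and
`h mod (u) = (X - λ̄)^m`, `m ≥ 1`, then `λ̄ = 0`.  (Otherwise `f_{m,X} ≡ (-λ̄)^m` is a unit, `0` is
the vertex `𝐒(f_{m,X})/m = {0}` of `Δ = ℝⁿ_{≥0}`, and `γ̄(f_{i,X}, 0) = C(m,i)(-λ̄)^i` says it is
solvable.) [cite: CossartPiltant2019, Prop. 2.3 (arXiv v1 pp. 11–12)] -/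
theorem IsMinimal.mem_span_of_map_eq_X_sub_C_pow [IsNoetherianRing S] [IsLocalRing S]
    {u : Fin N → S}
    (H : ∀ (i : Fin N) (T : Finset (Fin N)), i ∉ T →
      ∀ y, u i * y ∈ Ideal.span (u '' ↑T) → y ∈ Ideal.span (u '' ↑T))
    (hu : ∀ i, u i ∈ maximalIdeal S) (hP : (Ideal.span (Set.range u)).IsPrime)
    {h : S[X]} (hm : 1 ≤ h.natDegree) (hmin : IsMinimal u h) {lam : S}
    (hlam : h.map (Ideal.Quotient.mk (Ideal.span (Set.range u))) =
      (X - C (Ideal.Quotient.mk (Ideal.span (Set.range u)) lam)) ^ h.natDegree) :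
    lam ∈ Ideal.span (Set.range u) := by
  classical
  set 𝔫 := Ideal.span (Set.range u) with h𝔫
  set m := h.natDegree with hm'
  -- the coefficients modulo `(u)`: `f_{i,X} ≡ C(m, i) (-λ)^i`
  have hcoeff : ∀ i, i ≤ m → Ideal.Quotient.mk 𝔫 (h.coeff (m - i)) =
      Ideal.Quotient.mk 𝔫 ((m.choose i : S) * (-lam) ^ i) := by
    intro i hi
    have h1 : (h.map (Ideal.Quotient.mk 𝔫)).coeff (m - i) = Ideal.Quotient.mk 𝔫 (h.coeff (m - i)) :=
      Polynomial.coeff_map _ _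
    rw [← h1, hlam, sub_eq_add_neg, ← C_neg, coeff_X_add_C_pow, Nat.sub_sub_self hi,
      Nat.choose_symm hi, map_mul, map_pow, map_neg, map_natCast, mul_comm]
  by_contra hne
  -- `f_{m,X} ∉ (u)`
  have hfm : h.coeff 0 ∉ 𝔫 := by
    intro hmem
    have h1 := hcoeff m le_rfl
    rw [Nat.sub_self, Nat.choose_self, Nat.cast_one, one_mul] at h1
    rw [← Ideal.Quotient.eq_zero_iff_mem, h1, Ideal.Quotient.eq_zero_iff_mem] at hmem
    exact hne (neg_mem_iff.mp (hP.mem_of_pow_mem _ hmem))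
  apply hmin 0
  have hsum : ∑ j, (fun _ => (1 : ℝ)) j * (((0 : Fin N → ℕ) j : ℕ) : ℝ) = 0 := by simp
  refine ⟨⟨fun _ => 1, fun _ => one_pos, fun i hi a ha => ⟨?_, fun heq => ?_⟩, m, ?_, 0, ?_, ?_⟩,
    lam, fun i hi => ?_⟩
  · -- `0 ≤ |a| / i`
    have hipos : (0 : ℝ) < i := by exact_mod_cast (Finset.mem_Icc.mp hi).1
    rw [hsum]
    exact div_nonneg (weight_nonneg (fun _ => zero_le_one) a) hipos.le
  · -- `|a| / i = 0` forces `a = 0`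
    have hipos : (0 : ℝ) < i := by exact_mod_cast (Finset.mem_Icc.mp hi).1
    rw [hsum, div_eq_zero_iff, or_iff_left hipos.ne'] at heq
    have ha0 : ∀ j, a j = 0 := by
      intro j
      have hle : (a j : ℝ) ≤ weight (fun _ => (1 : ℝ)) a := by
        rw [weight_one]
        exact_mod_cast Finset.single_le_sum (f := fun l => a l) (fun _ _ => Nat.zero_le _)
          (Finset.mem_univ j)
      rw [heq] at hle
      exact_mod_cast le_antisymm hle (Nat.cast_nonneg _)
    funext j
    simp [ha0 j]
  · exact Finset.mem_Icc.mpr ⟨hm, le_rfl⟩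
  · rw [Nat.sub_self, minExponents_eq_singleton_zero u H hfm]
    exact Finset.mem_singleton_self _
  · funext j
    simp
  · rw [smul_zero, coeffClass_zero u H hu]
    exact hcoeff i (Finset.mem_Icc.mp hi).2

end Literature.AlgebraicGeometry.Resolution.CossartPiltant

/-! ## Specialization to part of a regular system of parameters -/

namespace Literature.AlgebraicGeometry.Resolution.IsRsopPart

open CossartPiltant

universe u

variable {R : Type u} [CommRing R] [IsLocalRing R] {n : ℕ} {z : Fin n → R}

/-- `𝐒^J(f)` has its defining properties for `z = (u_j)_{j ∈ J}` part of a regular system of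
parameters. [cite: CossartPiltant2019, Prop. 2.1 (arXiv v1 p. 10)] -/
theorem minExponents_spec (hz : IsRsopPart z) (f : R) :
    IsAntichain (· ≤ ·) (↑(minExponents z f) : Set (Fin n → ℕ)) ∧
      f ∈ Ideal.span (uPow z '' ↑(minExponents z f)) ∧
      ∀ B : Set (Fin n → ℕ), f ∈ Ideal.span (uPow z '' B) →
        ∀ a ∈ minExponents z f, ∃ b ∈ B, b ≤ a := by
  haveI := hz.isRegularLocalRing
  exact minExponents_spec' z hz.mem_span_image_of_mul_mem hz.mem_maximalIdeal f

/-- **Prop. 2.2, "only if"** for part of a regular system of parameters: a solvable vertex of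
`Δ_S(h; u_J; X)` is dissolved by some `X' = X - λ u^x`, giving a strictly smaller polyhedron.
[cite: CossartPiltant2019, Prop. 2.2 (arXiv v1 p. 11)] -/
theorem charPolyhedron_taylor_ssubset_of_isSolvableVertex (hz : IsRsopPart z) {h : R[X]}
    (hh : h.Monic) {x : Fin n → ℕ} (hx : IsSolvableVertex z h x) :
    ∃ lam : R, charPolyhedron z (taylor (lam * uPow z x) h) ⊂ charPolyhedron z h := by
  haveI := hz.isRegularLocalRing
  exact hx.charPolyhedron_taylor_ssubset hz.mem_span_image_of_mul_mem hz.mem_maximalIdeal hh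

/-- A smallest translate is minimal (Def. 2.4), for part of a regular system of parameters.
[cite: CossartPiltant2019, Prop. 2.2 and Def. 2.4 (arXiv v1 p. 11)] -/
theorem isMinimal_of_forall_subset (hz : IsRsopPart z) {h : R[X]} (hh : h.Monic)
    (hmin : ∀ θ : R, charPolyhedron z h ⊆ charPolyhedron z (taylor θ h)) : IsMinimal z h := by
  haveI := hz.isRegularLocalRing
  exact CossartPiltant.isMinimal_of_forall_subset hz.mem_span_image_of_mul_mem hz.mem_maximalIdeal
    hh hmin

/-- **Prop. 2.3, proof** for part of a regular system of parameters (`(z)` is prime): a minimal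
polyhedron with `h mod (z) = (X - λ̄)^m`, `m ≥ 1`, has `λ̄ = 0`.
[cite: CossartPiltant2019, Prop. 2.3 (arXiv v1 pp. 11–12)] -/
theorem mem_span_of_isMinimal_of_map_eq_X_sub_C_pow (hz : IsRsopPart z) {h : R[X]}
    (hm : 1 ≤ h.natDegree) (hmin : IsMinimal z h) {lam : R}
    (hlam : h.map (Ideal.Quotient.mk (Ideal.span (Set.range z))) =
      (X - C (Ideal.Quotient.mk (Ideal.span (Set.range z)) lam)) ^ h.natDegree) :
    lam ∈ Ideal.span (Set.range z) := by
  haveI := hz.isRegularLocalRing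
  exact hmin.mem_span_of_map_eq_X_sub_C_pow hz.mem_span_image_of_mul_mem hz.mem_maximalIdeal
    hz.isPrime_span_range hm hlam

end Literature.AlgebraicGeometry.Resolution.IsRsopPart
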